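import Summits.ABC.IUTFork.Cor312GenuineKDeepDatumLam
import Literature.IUT.LogVolume.GenuineTowerFactsSharp
import Literature.IUT.LogVolume.DepthConstantsTameBudget
import HarnessLib

/-!
# [IUTchIII] Cor. 3.12, branch C / R-W «HEX-SHARP» — the SHARP datum-side glue: at the bad place `x₀ | p` of brick H6 the
# ramification is `≤ e(v₀|p)·46080·l` (not `·l(l−1)²(l+1)`), so over `λ_k = 1/2 + 2/7^k`: `e ≤ 46080·l` and, for `l ≤ 107`,
# `d + a + b < 41/5`

PROOF-ONLY support file (D-0012; 0 definitions, 0 `Prop` facts) of the abc-iut cell (seat abc-iut-S-d1, gen 8; R-W sub-cell,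
HOME/plan/W/WINDOW-SPEC.md §6 «HEX-SHARP», the §6 (1) ENGINE). TAKES NO SIDE on [IUTchIII] Cor. 3.12 (S. Mochizuki,
*Inter-universal Teichmüller theory III*, RIMS manuscript, Cor. 3.12 p. 173–174) or on any author: classical algebraic number
theory on the cell's typed Θ-volume data.

It is abc-iut-c312-7's brick H6 `Conditional.GenuineK.exists_bad_tame_place_of_ord_neg` (`Cor312GenuineKDeepDatum`, p44x ✓) with ONE
step sharpened: the relative index `e(x₀|v)` of `K/F` at the bad place is bounded by **`l`** — [IUTchIV] Prop. 1.8 (vii) "divides `l`"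
(`Literature.IUT.LogVolume.Cor22.ThetaVolumeDatumAt.ramificationIdx_le_prime`, this seat's `GenuineTowerFactsSharp`: `e = l^k` divides
`[K:F] ∣ #GL₂(𝔽_l)`) — instead of by `[K:F] ≤ l(l−1)²(l+1)`. Everything else (the place `x₀`, its badness, tameness, the norm of the
CHOSEN realising q-idele) is c312-7's construction VERBATIM (re-run, since H6 hides the place behind `∃`).

* `GenuineK.exists_bad_tame_place_of_ord_neg_sharp` — H6 with `e(K_{x₀}/ℚ_p) ≤ e(v₀|p)·46080·l`;
* `GenuineK.exists_place_lamSeven_sharp` — at `(ratPoint λ_k, l)`, `k ≥ 1`, `l` prime `≥ 11`: `x₀ | 7` bad, `7 ∤ e`, **`e ≤ 46080·l`**,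
  `‖t_q(x₀)‖ = 7^{−k/l}`;
* `GenuineK.exists_place_lamSeven_dab_lt` — for `l ≤ 107` moreover **`d + a + b < 41/5`** (`46080·l ≤ 4 930 560 < 6·7⁷`; this seat's
  `Literature.IUT.LogVolume.depthConstants_seven_lt_41_5`, p455792 ✓) — against `2 + log₇(46080·l(l−1)²(l+1)) ≈ 12.4` (at `l = 11`)
  of `GenuineK.exists_place_lamSeven`. Downstream (`Conditional/AbcOfSGenuineKChosenDepthHexSharp24`): the explicit depth inequality
  for EVERY `k ≥ 24`, uniformly in `11 ≤ l ≤ 107`.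

HONEST FRAMING: bookkeeping over OUR typed objects at the cell's sharp honestly-scaled genuine setting; nothing here bears on the
printed inequality of [IUTchIII] Cor. 3.12 or on the number-level `Cor22.Cor312AtDatum`; typed ≠ proved; instantiated ≠ endorsed.
[cite: Mochizuki2012, IUTchI Ex. 3.2 (iv) p. 71; IUTchIV Prop. 1.8 (vii) p. 19, Thm. 1.10 Steps (ii)–(iii) p. 24–26, Cor. 2.2 (P5) p. 46]
[claim: Mochizuki2012, status: disputed] for every IUT quotation.
-/

noncomputable section

open NumberField IsDedekindDomain

namespace Summit.ABC.IUTFork.Conditional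

open Thm311 Thm311.Real Cor312 Cor312Prov Literature.IUT.LogVolume Literature.IUT.HodgeTheaters
  Literature.IUT.LogThetaLattice Literature.NumberTheory.NumberFields Literature.NumberTheory.DiophantineGeometry.GenEll
  Literature.NumberTheory.DiophantineGeometry

variable {P : NFPoint} {l : ℕ} (T : Cor22.ThetaVolumeDatumAt P l)

/-! ## §1. Brick H6, sharp: `e(K_{x₀}/ℚ_p) ≤ e(v₀|p)·46080·l` -/

/-- **Brick H6 with the SHARP ramification bound.** For a genuine Θ-volume datum `T` at `(P, l)` with `P ∈ UP`, `l` prime, a prime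
`p ∉ {2, 3, 5}`, `p ≠ l`, and a place `v₀` of `F_tpd = P.F` over `p` with `p ∤ e(v₀|p)` at which `j(λ)` has a pole of order `m ≥ 1`:
there is a point `x₀` of the fibre over `p` of the index of `pilotDataOfK T.D T.K` whose place is BAD (`∈ S`), TAME
(`p ∤ e(K_{x₀}/ℚ_p)`), of ramification **`≤ e(v₀|p)·46080·l`** (`e(v|v₀) ≤ 46080` by `Gal(F/F_tpd) ↪ GL₂(𝔽₃)×GL₂(𝔽₅)×ℤ/2`, and
`e(x₀|v) ≤ l` by [IUTchIV] Prop. 1.8 (vii)), at which the CHOSEN realising q-idele has norm EXACTLY `p^{−m/(2·l·e(v₀|p))}`.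
(abc-iut-c312-7's `GenuineK.exists_bad_tame_place_of_ord_neg`, one bound sharpened.)
[cite: Mochizuki2012, IUTchIV Prop. 1.8 (vii) p. 19; Thm. 1.10 Steps (ii)–(iii) p. 24–26] [claim: Mochizuki2012, status: disputed] -/
theorem GenuineK.exists_bad_tame_place_of_ord_neg_sharp (hP : P ∈ UP) (hl : l.Prime) (pp : Nat.Primes)
    (hp2 : (pp : ℕ) ≠ 2) (hp3 : (pp : ℕ) ≠ 3) (hp5 : (pp : ℕ) ≠ 5) (hpl : (pp : ℕ) ≠ l)
    (v₀ : HeightOneSpectrum (𝓞 P.F)) (hv₀ : ((pp : ℕ) : 𝓞 P.F) ∈ v₀.asIdeal) (hv₀e : ¬ (pp : ℕ) ∣ ramIdx P.F v₀)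
    {m : ℕ} (hm : Literature.IUT.LogVolume.ord P.F v₀ (Cor22.jInv P.x) = -(m : ℤ)) (hm0 : 0 < m) :
    letI := T.instFieldF; letI := T.instNumberFieldF; letI := T.instAlgebraF; letI := T.instFieldK
    letI := T.instNumberFieldK; letI := T.instAlgebraK; letI := T.instFieldFbar; letI := T.instAlgebraFbar
    letI := T.instAlgebraKFbar; letI := T.instIsElliptic
    haveI : Fact (pp : ℕ).Prime := ⟨pp.2⟩
    ∃ x₀ : (thetaIndex (pilotDataOfK T.D T.K)).Fibre (.inr pp),
      placeOf (pilotDataOfK T.D T.K) pp.1 x₀ ∈ (pilotDataOfK T.D T.K).S ∧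
      ¬ (pp : ℕ) ∣ absRamificationIdx (pp : ℕ) (kOf (pilotDataOfK T.D T.K) pp.1 x₀) ∧
      absRamificationIdx (pp : ℕ) (kOf (pilotDataOfK T.D T.K) pp.1 x₀) ≤ ramIdx P.F v₀ * 46080 * l ∧
      ‖(exists_realising_qIdeles_pilotDataOfK T.D).choose pp x₀‖ =
        ((pp : ℕ) : ℝ) ^ (-((m : ℝ) / (2 * l * ramIdx P.F v₀))) := by
  letI := T.instFieldF; letI := T.instNumberFieldF; letI := T.instAlgebraF; letI := T.instFieldK
  letI := T.instNumberFieldK; letI := T.instAlgebraK; letI := T.instFieldFbar; letI := T.instAlgebraFbar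
  letI := T.instAlgebraKFbar; letI := T.instIsElliptic
  haveI : Fact (pp : ℕ).Prime := ⟨pp.2⟩
  have hU : P.InU := hP.1
  set X := pilotDataOfK T.D T.K with hXdef
  -- the nine tower facts (Steps (ii)–(iii)) and the sharp one
  obtain ⟨hGalF, hGalK, -, -, -, -, hKbad, -, hFtame⟩ := T.towerFacts hU
  have hKle := T.ramificationIdx_le_prime
  haveI := hGalF; haveI := hGalK
  -- places: `v` of `F` over `v₀`, `w` of `K` over `v`
  obtain ⟨v, hv⟩ := exists_finBelow_eq (L := T.F) v₀
  obtain ⟨w, hw⟩ := exists_finBelow_eq (L := T.K) v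
  have hpv : ((pp : ℕ) : 𝓞 T.F) ∈ v.asIdeal := by
    have : ((pp : ℕ) : 𝓞 T.F) = algebraMap (𝓞 P.F) (𝓞 T.F) ((pp : ℕ) : 𝓞 P.F) := by simp
    rw [this, ← Ideal.mem_comap]
    change ((pp : ℕ) : 𝓞 P.F) ∈ (finBelow P.F T.F v).asIdeal
    rw [hv]; exact hv₀
  have hpw : ((pp : ℕ) : 𝓞 T.K) ∈ w.asIdeal := by
    have : ((pp : ℕ) : 𝓞 T.K) = algebraMap (𝓞 T.F) (𝓞 T.K) ((pp : ℕ) : 𝓞 T.F) := by simp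
    rw [this, ← Ideal.mem_comap]
    change ((pp : ℕ) : 𝓞 T.F) ∈ (finBelow T.F T.K w).asIdeal
    rw [hw]; exact hpv
  have hwchar : residueChar T.K w = (pp : ℕ) := residueChar_eq_of_natCast_mem pp.1 hpw
  have hvchar : residueChar T.F v = (pp : ℕ) := residueChar_eq_of_natCast_mem pp.1 hpv
  -- the fibre point `x₀` with `placeOf x₀ = w`
  have hwover : w ∈ placesOver T.K (pp : ℕ) := (mem_placesOver_iff_residueChar w).mpr hwchar
  let x₀ : (thetaIndex X).Fibre (.inr pp) := (fibreEquivPlacesOver X pp).symm ⟨w, hwover⟩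
  have hx₀ : placeOf X pp.1 x₀ = w := by
    change ((fibreEquivPlacesOver X pp) ((fibreEquivPlacesOver X pp).symm ⟨w, hwover⟩)).1 = w
    rw [Equiv.apply_symm_apply]
  -- `v₀` is a pole of `j(λ)`, so `v` is bad for the point over `F`, so `E_F` is multiplicative at `v`
  have hv₀bad : v₀ ∈ Cor22.badPlaces P := by
    rw [Cor22.mem_badPlaces_iff_ord_neg, hm]
    have : (0 : ℤ) < m := by exact_mod_cast hm0
    linarith
  have hordv : Literature.IUT.LogVolume.ord T.F v T.E.j < 0 := by
    rw [T.j_eq, Cor22.ord_algebraMap_neg_iff v, hv, hm]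
    have : (0 : ℤ) < m := by exact_mod_cast hm0
    linarith
  have hj0 : T.E.j ≠ 0 := by
    intro h0
    rw [h0, ord_zero] at hordv
    exact lt_irrefl _ hordv
  have hmult : T.E.HasMultiplicativeReductionAt v := by
    rcases T.D.isSemistable v with hgood | hmult
    · have h1 : v.valuation T.F T.E.j ≤ 1 := valuation_j_le_one_of_hasGoodReduction_localMinimalModel v T.E hgood
      have h2 : 1 < v.valuation T.F T.E.j := (ord_neg_iff_one_lt_valuation T.F v hj0).mp hordv
      exact absurd h1 (not_le.mpr h2)
    · exact hmult
  -- hence `v ∈ 𝕍(F)^bad` by the (P5) choice (`p ∤ 2l`)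
  have hvVFbad : FinitePlace.mk v ∈ T.D.VFbad := by
    rw [T.isP5Choice (FinitePlace.mk v), FinitePlace.maximalIdeal_mk]
    refine ⟨fun q hq hqv => ?_, hmult⟩
    simp only [Finset.mem_insert, Finset.mem_singleton] at hq
    have hq' : q = (pp : ℕ) := by
      rcases hq with rfl | rfl
      · exact eq_of_natCast_mem_of_prime pp.1 v.isPrime.ne_top Nat.prime_two hqv hpv
      · exact eq_of_natCast_mem_of_prime pp.1 v.isPrime.ne_top hl hqv hpv
    rcases hq with rfl | rfl
    · exact hp2 hq'.symm
    · exact hpl hq'.symm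
  -- so `w ∈ S` for the `K`-level pilot datum
  have hwS : w ∈ X.S := by
    rw [hXdef, mem_pilotDataOfK_S_iff, hw]; exact hvVFbad
  have hx₀S : placeOf X pp.1 x₀ ∈ X.S := by rw [hx₀]; exact hwS
  -- ramification bookkeeping: `e(w|p) = e(v₀|p)·e(v|v₀)·e(w|v)`
  have hv_under : v.under (𝓞 P.F) = v₀ := hv
  have hw_under : w.under (𝓞 T.F) = v := hw
  haveI hwv : w.asIdeal.LiesOver v.asIdeal := by rw [← hw_under]; exact ⟨rfl⟩
  haveI hvv₀ : v.asIdeal.LiesOver v₀.asIdeal := by rw [← hv_under]; exact ⟨rfl⟩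
  haveI : v.asIdeal.IsMaximal := v.isMaximal
  haveI : v₀.asIdeal.IsMaximal := v₀.isMaximal
  have hewv : Ideal.ramificationIdx' v.asIdeal w.asIdeal = w.asIdeal.ramificationIdx (𝓞 T.F) :=
    Ideal.ramificationIdx'_eq_ramificationIdx v.asIdeal w.asIdeal v.ne_bot
  have hevv₀ : Ideal.ramificationIdx' v₀.asIdeal v.asIdeal = v.asIdeal.ramificationIdx (𝓞 P.F) :=
    Ideal.ramificationIdx'_eq_ramificationIdx v₀.asIdeal v.asIdeal v₀.ne_bot
  have hew : w.asIdeal.ramificationIdx ℤ =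
      ramIdx P.F v₀ * Ideal.ramificationIdx' v₀.asIdeal v.asIdeal * Ideal.ramificationIdx' v.asIdeal w.asIdeal := by
    rw [ThetaData.absRamificationIdx_eq_ramIdx_mul (F := T.F) w, hw_under, ramIdx_eq,
      ThetaData.absRamificationIdx_eq_ramIdx_mul (F := P.F) v, hv_under]
  have hekOf : absRamificationIdx (pp : ℕ) (kOf X pp.1 x₀) = w.asIdeal.ramificationIdx ℤ := by
    have hpx : ((pp : ℕ) : 𝓞 T.K) ∈ (placeOf X pp.1 x₀).asIdeal := natCast_mem_placeOf X pp.1 x₀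
    rw [show absRamificationIdx (pp : ℕ) (kOf X pp.1 x₀) =
        absRamificationIdx (pp : ℕ) (RescaledCompletion T.K pp.1 (placeOf X pp.1 x₀) hpx) from rfl,
      absRamificationIdx_rescaledCompletion]
    simp only [hx₀]
  -- tameness of the two relative layers at `p`
  have htameK : ¬ (pp : ℕ) ∣ Ideal.ramificationIdx' v.asIdeal w.asIdeal := by
    rw [hewv]
    have h := hKbad w (by rw [hwchar]; exact hpl) (by
      change finBelow P.F T.F (finBelow T.F T.K w) ∈ Cor22.badPlaces P
      rw [hw, hv]; exact hv₀bad)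
    rwa [hwchar] at h
  have htameF : ¬ (pp : ℕ) ∣ Ideal.ramificationIdx' v₀.asIdeal v.asIdeal := by
    rw [hevv₀]
    have h := hFtame v (by
      rw [hvchar]
      simp only [Finset.mem_insert, Finset.mem_singleton, not_or]
      exact ⟨hp2, hp3, hp5⟩)
    rwa [hvchar] at h
  have htame : ¬ (pp : ℕ) ∣ absRamificationIdx (pp : ℕ) (kOf X pp.1 x₀) := by
    rw [hekOf, hew]
    intro h
    rcases (Nat.Prime.dvd_mul pp.2).1 h with h12 | h3
    · rcases (Nat.Prime.dvd_mul pp.2).1 h12 with h1 | h2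
      · exact hv₀e h1
      · exact htameF h2
    · exact htameK h3
  -- the SHARP bound `e(w|p) ≤ e(v₀|p)·46080·l`
  have hevv₀le : Ideal.ramificationIdx' v₀.asIdeal v.asIdeal ≤ 46080 := by
    rw [hevv₀]
    refine Cor22.ramificationIdx_subThetaField_le T.F hU T.isSubThetaField v ?_
    change ¬ ((2 : ℕ) : 𝓞 P.F) ∈ (finBelow P.F T.F v).asIdeal
    rw [hv]
    intro h2
    exact hp2 (eq_of_natCast_mem_of_prime pp.1 v₀.isPrime.ne_top Nat.prime_two h2 hv₀).symm
  have hewvle : Ideal.ramificationIdx' v.asIdeal w.asIdeal ≤ l := by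
    rw [hewv]
    exact hKle w (by rw [hwchar]; exact hpl)
  have hbound : absRamificationIdx (pp : ℕ) (kOf X pp.1 x₀) ≤ ramIdx P.F v₀ * 46080 * l := by
    rw [hekOf, hew]
    exact Nat.mul_le_mul (Nat.mul_le_mul le_rfl hevv₀le) hewvle
  -- the norm of the chosen realising q-idele at `x₀`
  obtain ⟨mq, hmq, hnorm⟩ := exists_int_norm_qIdele_pilotDataOfK T.D pp
    (exists_realising_qIdeles_pilotDataOfK T.D).choose (exists_realising_qIdeles_pilotDataOfK T.D).choose_spec.1
    (exists_realising_qIdeles_pilotDataOfK T.D).choose_spec.2.2 x₀ hx₀S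
  have hexp := qExponent_div_eq_pilotDataOfK T.D pp x₀ hx₀S hmq
  -- `qParamOrd E v = e(v|v₀)·m`
  have hfb : finBelow T.F T.K (placeOf X pp.1 x₀) = v := by rw [hx₀]; exact hw
  have hq : (qParamOrd T.E v : ℤ) = (Ideal.ramificationIdx' v₀.asIdeal v.asIdeal : ℤ) * m := by
    have h1 := ThetaData.neg_ord_j_eq_ramificationIdx_mul_qParamOrd_of_under_mem_VFbad T.D (w := w)
      (by rw [hw_under]; exact hvVFbad)
    rw [hw_under] at h1
    have h2 : Literature.IUT.LogVolume.ord T.K w (algebraMap T.F T.K T.E.j) =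
        (Ideal.ramificationIdx' v.asIdeal w.asIdeal : ℤ) * ((Ideal.ramificationIdx' v₀.asIdeal v.asIdeal : ℤ) * (-(m : ℤ))) := by
      rw [Cor22.ord_algebraMap_eq w, hw, T.j_eq, Cor22.ord_algebraMap_eq v, hv, hm]
    rw [h2] at h1
    have hne : (Ideal.ramificationIdx' v.asIdeal w.asIdeal : ℤ) ≠ 0 := by
      exact_mod_cast Ideal.IsDedekindDomain.ramificationIdx'_ne_zero_of_liesOver w.asIdeal v.ne_bot
    have h3 : (Ideal.ramificationIdx' v.asIdeal w.asIdeal : ℤ) * (qParamOrd T.E v : ℤ) =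
        (Ideal.ramificationIdx' v.asIdeal w.asIdeal : ℤ) * ((Ideal.ramificationIdx' v₀.asIdeal v.asIdeal : ℤ) * m) := by
      linarith
    exact mul_left_cancel₀ hne h3
  -- `ramIdx F v = e(v₀|p)·e(v|v₀)`
  have hramv : (ramIdx T.F v : ℝ) = (ramIdx P.F v₀ : ℝ) * Ideal.ramificationIdx' v₀.asIdeal v.asIdeal := by
    rw [ramIdx_eq, ThetaData.absRamificationIdx_eq_ramIdx_mul (F := P.F) v, hv_under]
    push_cast
    rfl
  refine ⟨x₀, hx₀S, htame, hbound, ?_⟩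
  rw [hnorm, hexp, hfb]
  congr 1
  have hl0 : (l : ℝ) ≠ 0 := by exact_mod_cast hl.ne_zero
  have he0 : (ramIdx P.F v₀ : ℝ) ≠ 0 := by exact_mod_cast ramIdx_ne_zero P.F v₀
  have hr0 : (Ideal.ramificationIdx' v₀.asIdeal v.asIdeal : ℝ) ≠ 0 := by
    exact_mod_cast Ideal.IsDedekindDomain.ramificationIdx'_ne_zero_of_liesOver v.asIdeal v₀.ne_bot
  have hq' : (qParamOrd T.E v : ℝ) = (Ideal.ramificationIdx' v₀.asIdeal v.asIdeal : ℝ) * m := by exact_mod_cast hq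
  rw [hq', hramv]
  field_simp

/-! ## §2. The `λ_k = 1/2 + 2/7^k` datum: `e ≤ 46080·l`, and `d + a + b < 41/5` for `l ≤ 107` -/

/-- **The `λ_k` datum's bad place over `7`, SHARP.** For `k ≥ 1`, `l` prime `≥ 11` and a genuine Θ-volume datum `T` at
`(ratPoint λ_k, l)`: a place `x₀ | 7` of `K = T.K` in the bad set of `pilotDataOfK T.D T.K`, TAME over `ℚ_7`, of ramification
**`≤ 46080·l`**, at which the CHOSEN realising q-idele has `‖t_q(x₀)‖ = 7^{−k/l}` EXACTLY.
[cite: Mochizuki2012, IUTchIV Prop. 1.8 (vii) p. 19, Cor. 2.2 (ii) proof (P5) p. 46] [claim: Mochizuki2012, status: disputed] -/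
theorem GenuineK.exists_place_lamSeven_sharp {k l : ℕ} (hk : 1 ≤ k) (hl : l.Prime) (h11 : 11 ≤ l)
    (T : Cor22.ThetaVolumeDatumAt (ratPoint ((2 : ℚ)⁻¹ + 2 / 7 ^ k)) l) :
    letI := T.instFieldF; letI := T.instNumberFieldF; letI := T.instAlgebraF; letI := T.instFieldK
    letI := T.instNumberFieldK; letI := T.instAlgebraK; letI := T.instFieldFbar; letI := T.instAlgebraFbar
    letI := T.instAlgebraKFbar; letI := T.instIsElliptic
    haveI : Fact (Nat.Prime 7) := ⟨by norm_num⟩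
    ∃ x₀ : (thetaIndex (pilotDataOfK T.D T.K)).Fibre (.inr ⟨7, by norm_num⟩),
      placeOf (pilotDataOfK T.D T.K) 7 x₀ ∈ (pilotDataOfK T.D T.K).S ∧
      ¬ 7 ∣ absRamificationIdx 7 (kOf (pilotDataOfK T.D T.K) 7 x₀) ∧
      absRamificationIdx 7 (kOf (pilotDataOfK T.D T.K) 7 x₀) ≤ 46080 * l ∧
      ‖(exists_realising_qIdeles_pilotDataOfK T.D).choose ⟨7, by norm_num⟩ x₀‖ = (7 : ℝ) ^ (-((k : ℝ) / l)) := by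
  letI := T.instFieldF; letI := T.instNumberFieldF; letI := T.instAlgebraF; letI := T.instFieldK
  letI := T.instNumberFieldK; letI := T.instAlgebraK; letI := T.instFieldFbar; letI := T.instAlgebraFbar
  letI := T.instAlgebraKFbar; letI := T.instIsElliptic
  haveI : Fact (Nat.Prime 7) := ⟨by norm_num⟩
  -- the place `(7)` of `ℚ = (ratPoint λ_k).F`
  let v₀ : HeightOneSpectrum (𝓞 ℚ) := (Rat.HeightOneSpectrum.primesEquiv (R := 𝓞 ℚ)).symm ⟨7, by norm_num⟩
  have hv₀gen : Rat.HeightOneSpectrum.natGenerator v₀ = 7 := by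
    have h := congrArg Subtype.val ((Rat.HeightOneSpectrum.primesEquiv (R := 𝓞 ℚ)).apply_symm_apply ⟨7, by norm_num⟩)
    exact h
  have hv₀ : ((7 : ℕ) : 𝓞 ℚ) ∈ v₀.asIdeal := by
    rw [UniformABCConjecture.natCast_mem_asIdeal_iff, hv₀gen]
  have hram : ramIdx ℚ v₀ = 1 := by
    have h1 := ramificationIdx_int_le_finrank_rat (F₀ := ℚ) v₀
    rw [Module.finrank_self, ← ramIdx_eq] at h1
    have h2 : ramIdx ℚ v₀ ≠ 0 := ramIdx_ne_zero ℚ v₀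
    omega
  have hv₀e : ¬ (7 : ℕ) ∣ ramIdx ℚ v₀ := by rw [hram]; decide
  have hm : Literature.IUT.LogVolume.ord ℚ v₀ (Cor22.jInv ((2 : ℚ)⁻¹ + 2 / 7 ^ k)) = -((2 * k : ℕ) : ℤ) := by
    rw [Cor22.ord_jInv_lamSeven v₀ hv₀gen hk]; push_cast; ring
  have hP : ratPoint ((2 : ℚ)⁻¹ + 2 / 7 ^ k) ∈ UP := Cor22.ratPoint_lamSeven_mem_UP hk
  obtain ⟨x₀, hS, htame, hbound, hnorm⟩ :=
    GenuineK.exists_bad_tame_place_of_ord_neg_sharp T hP hl ⟨7, by norm_num⟩ (by norm_num) (by norm_num) (by norm_num)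
      (show (7 : ℕ) ≠ l by omega) v₀ hv₀ hv₀e hm (by omega)
  -- read the outputs over `ℚ = (ratPoint λ_k).F` (definitional) and substitute `e(v₀|7) = 1`
  have hb' : absRamificationIdx 7 (kOf (pilotDataOfK T.D T.K) 7 x₀) ≤ 46080 * l := by
    have h' : absRamificationIdx 7 (kOf (pilotDataOfK T.D T.K) 7 x₀) ≤ ramIdx ℚ v₀ * 46080 * l := hbound
    rwa [hram, one_mul] at h'
  have hnorm' : ‖(exists_realising_qIdeles_pilotDataOfK T.D).choose ⟨7, by norm_num⟩ x₀‖ =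
      (7 : ℝ) ^ (-(((2 * k : ℕ) : ℝ) / (2 * l * (ramIdx ℚ v₀ : ℝ)))) := hnorm
  refine ⟨x₀, hS, htame, hb', ?_⟩
  rw [hnorm', hram]
  congr 1
  have hl0 : (l : ℝ) ≠ 0 := by exact_mod_cast hl.ne_zero
  push_cast
  field_simp

/-- **… and for `l ≤ 107` the [IUTchIV] Prop. 1.1/1.2 constants at that place satisfy `d + a + b < 41/5`** (`e ≤ 46080·l ≤ 4 930 560
< 6·7⁷ = 4 941 258` and `7 ∤ e`: `Literature.IUT.LogVolume.depthConstants_seven_lt_41_5`, this seat's p455792) — the per-factor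
exponent constant of the explicit depth inequality with the HEX-SHARP budget `C ≤ 83/10` (HOME/plan/W/WINDOW-SPEC.md §6 (3)).
[cite: Mochizuki2012, IUTchIV Prop. 1.2 p. 10, Prop. 1.8 (vii) p. 19] [claim: Mochizuki2012, status: disputed] -/
theorem GenuineK.exists_place_lamSeven_dab_lt {k l : ℕ} (hk : 1 ≤ k) (hl : l.Prime) (h11 : 11 ≤ l) (h107 : l ≤ 107)
    (T : Cor22.ThetaVolumeDatumAt (ratPoint ((2 : ℚ)⁻¹ + 2 / 7 ^ k)) l) :
    letI := T.instFieldF; letI := T.instNumberFieldF; letI := T.instAlgebraF; letI := T.instFieldK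
    letI := T.instNumberFieldK; letI := T.instAlgebraK; letI := T.instFieldFbar; letI := T.instAlgebraFbar
    letI := T.instAlgebraKFbar; letI := T.instIsElliptic
    haveI : Fact (Nat.Prime 7) := ⟨by norm_num⟩
    ∃ x₀ : (thetaIndex (pilotDataOfK T.D T.K)).Fibre (.inr ⟨7, by norm_num⟩),
      placeOf (pilotDataOfK T.D T.K) 7 x₀ ∈ (pilotDataOfK T.D T.K).S ∧
      differentOrd 7 (kOf (pilotDataOfK T.D T.K) 7 x₀)
          + logRadiusA 7 (absRamificationIdx 7 (kOf (pilotDataOfK T.D T.K) 7 x₀))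
          + logRadiusB 7 (absRamificationIdx 7 (kOf (pilotDataOfK T.D T.K) 7 x₀)) < 41 / 5 ∧
      ‖(exists_realising_qIdeles_pilotDataOfK T.D).choose ⟨7, by norm_num⟩ x₀‖ = (7 : ℝ) ^ (-((k : ℝ) / l)) := by
  letI := T.instFieldF; letI := T.instNumberFieldF; letI := T.instAlgebraF; letI := T.instFieldK
  letI := T.instNumberFieldK; letI := T.instAlgebraK; letI := T.instFieldFbar; letI := T.instAlgebraFbar
  letI := T.instAlgebraKFbar; letI := T.instIsElliptic
  haveI : Fact (Nat.Prime 7) := ⟨by norm_num⟩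
  obtain ⟨x₀, hS, htame, hbound, hnorm⟩ := GenuineK.exists_place_lamSeven_sharp hk hl h11 T
  refine ⟨x₀, hS, ?_, hnorm⟩
  exact depthConstants_seven_lt_41_5 7 (kOf (pilotDataOfK T.D T.K) 7 x₀) rfl htame (by omega)

end Summit.ABC.IUTFork.Conditional

end
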